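import Summits.BirchSwinnertonDyer.Rank1Residual.X11b.Three.CornerSplitResidual
import HarnessLib

/-!
# Sketch — crux idea F «one-datum re-cut + unit/exact-twin supply» for item 19111 `CornerAtThree`
(planner-bsd-stepL-mult-idea g4; elaboration check only; nothing here is filed in the tree).

The (Tw) conjunct `X11b.Three.CornerTwistAt W` (∀ odd Heegner field `K`) is CONSUMED at ONE datum by
both corner consumers (`exists_oddHeegnerData`).  We type:

* `CornerTwistWitnessAt W` — the ∃-recut (one odd Heegner field with `d_K < -4`, `L(E^{d_K},1) ≠ 0`
  and the rank-0 `3`-part of BSD of a minimal model of the twist);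
* `cornerTwistWitnessAt_of_cornerTwistAt` — the recut is WEAKER than the filed conjunct (kernel);
* `UnitTwinSupplyAt W` (t0 = `3 ∤ ∏ c_ℓ(E)`) and `ExactTwinSupplyAt W` (all corner pairs) — the new
  crux F1 «some odd Heegner twin has `3`-adic unit analytic Sha» in L-value / `shaAn` currency;
* `missingLowerBoundAt_three_of_shaAn_unit` — at such a twin the lower half `TwistLower` is free.
-/

open scoped Classical

open WeierstrassCurve NumberField Literature.NumberTheory.EllipticCurves
  Literature.NumberTheory.EllipticCurves.ModularForms
  Literature.NumberTheory.EllipticCurves.Rank1Residual IsDedekindDomain Field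
  Literature.NumberTheory.QuadraticFields.Quadratic
  Literature.NumberTheory.Automorphic
  Literature.NumberTheory.GaloisRepresentations Literature.NumberTheory.GaloisCohomology
  Summit.BirchSwinnertonDyer.Rank1Residual Summit.BirchSwinnertonDyer.Rank1Residual.X11b
  Summit.BirchSwinnertonDyer.Rank1Residual.X11b.Three

namespace Summit.BirchSwinnertonDyer.BirchSwinnertonDyer.Cruxes.CornerAtThree.OneDatumUnitTwin

/-- **The ∃-recut of the (Tw) conjunct.** For a (T4″)@3 corner pair `(E,3)`: SOME imaginary quadratic
`K` with odd `d_K < -4`, every `ℓ ∣ N(E)` split in `K` (so `3` split, `3 ∤ d_K`, `w_K = 2`),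
`L(E^{(d_K)},1) ≠ 0`, and the rank-`0` `3`-part of BSD for a global minimal model `Wd` of `E^{(d_K)}`. -/
def CornerTwistWitnessAt (W : WeierstrassCurve ℚ) [W.IsElliptic] [W.IsGloballyMinimal] : Prop :=
  ClassX11b W 3 → ¬ Surj W 3 →
    ∃ (K : Type) (_ : Field K) (_ : NumberField K)
      (Wd : WeierstrassCurve ℚ) (_ : Wd.IsElliptic) (_ : Wd.IsGloballyMinimal) (Cd : VariableChange ℚ),
      IsImaginaryQuadratic K ∧ Odd (NumberField.discr K) ∧ NumberField.discr K < -4 ∧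
        SatisfiesHeegnerHypothesis (W.conductorNorm ℤ) K ∧ SatisfiesHeegnerHypothesis 3 K ∧
        (W.quadraticTwist (NumberField.discr K : ℚ)).entireLFunction 1 ≠ 0 ∧
        Cd • W.quadraticTwist (NumberField.discr K : ℚ) = Wd ∧ BSDp Wd 3

/-- Class-wide form (the proposed replacement item for the (Tw) conjunct of `CornerAtThree`). -/
def CornerTwistWitness : Prop :=
  ∀ (W : WeierstrassCurve ℚ) [W.IsElliptic] [W.IsGloballyMinimal], CornerTwistWitnessAt W

/-- **F1 on t0 (`3 ∤ ∏ c_ℓ(E)`, 88 class pairs, all non-split at 3): a UNIT-VALUE odd Heegner twin.**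
Some odd Heegner field as above at which the Néron-normalised central value `L(Wd,1)/Ω(Wd)` of the
minimal twist is a non-zero rational `3`-adic unit. -/
def UnitTwinSupplyAt (W : WeierstrassCurve ℚ) [W.IsElliptic] [W.IsGloballyMinimal] : Prop :=
  ClassX11b W 3 → ¬ Surj W 3 → ¬ 3 ∣ W.tamagawaProduct →
    ∃ (K : Type) (_ : Field K) (_ : NumberField K)
      (Wd : WeierstrassCurve ℚ) (_ : Wd.IsElliptic) (_ : Wd.IsGloballyMinimal) (Cd : VariableChange ℚ),
      IsImaginaryQuadratic K ∧ Odd (NumberField.discr K) ∧ NumberField.discr K < -4 ∧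
        SatisfiesHeegnerHypothesis (W.conductorNorm ℤ) K ∧ SatisfiesHeegnerHypothesis 3 K ∧
        (W.quadraticTwist (NumberField.discr K : ℚ)).entireLFunction 1 ≠ 0 ∧
        Cd • W.quadraticTwist (NumberField.discr K : ℚ) = Wd ∧
        ∃ q : ℚ, q ≠ 0 ∧ Wd.entireLFunction 1 / (Wd.realPeriodRat : ℂ) = (q : ℂ) ∧ padicValRat 3 q = 0

/-- **F1 on the whole corner (296 class pairs): an EXACT-VALUATION odd Heegner twin**, i.e. one whose
analytic Sha `shaAn Wd = L(Wd,1)·#tors²/(Ω·∏c·Reg)` is a non-zero rational `3`-adic unit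
(`ord₃ L(Wd,1)/Ω(Wd) = ord₃ ∏ c_ℓ(E)`, the minimum allowed by Gross–Kohnen–Zagier collinearity). -/
def ExactTwinSupplyAt (W : WeierstrassCurve ℚ) [W.IsElliptic] [W.IsGloballyMinimal] : Prop :=
  ClassX11b W 3 → ¬ Surj W 3 →
    ∃ (K : Type) (_ : Field K) (_ : NumberField K)
      (Wd : WeierstrassCurve ℚ) (_ : Wd.IsElliptic) (_ : Wd.IsGloballyMinimal) (Cd : VariableChange ℚ),
      IsImaginaryQuadratic K ∧ Odd (NumberField.discr K) ∧ NumberField.discr K < -4 ∧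
        SatisfiesHeegnerHypothesis (W.conductorNorm ℤ) K ∧ SatisfiesHeegnerHypothesis 3 K ∧
        (W.quadraticTwist (NumberField.discr K : ℚ)).entireLFunction 1 ≠ 0 ∧
        Cd • W.quadraticTwist (NumberField.discr K : ℚ) = Wd ∧
        ∃ q : ℚ, q ≠ 0 ∧ shaAn Wd = (q : ℂ) ∧ padicValRat 3 q = 0

/-- Class-wide F1 (the new crux, corner-wide). -/
def ExactTwinSupply : Prop :=
  ∀ (W : WeierstrassCurve ℚ) [W.IsElliptic] [W.IsGloballyMinimal], ExactTwinSupplyAt W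

/-! ### Kernels (elementary; evidence that the recut is sound and that the lower half is free) -/

/-- **At a twin with unit analytic Sha the `≥`-half (`TwistLower`) is free**: `ord₃ #Ш_an = 0 ≤ ord₃ #Ш`. -/
theorem missingLowerBoundAt_three_of_shaAn_unit (Wd : WeierstrassCurve ℚ) [Wd.IsElliptic]
    (h : ∃ q : ℚ, shaAn Wd = (q : ℂ) ∧ padicValRat 3 q = 0) : Typed.MissingLowerBoundAt Wd 3 := by
  obtain ⟨q, hq, hv⟩ := h
  exact ⟨q, hq, by rw [hv]; exact_mod_cast Nat.zero_le _⟩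

/-- **The ∃-recut is implied by the filed ∀-conjunct** (so replacing (Tw) by it loses nothing):
Hoffstein–Luo supplies an admissible odd Heegner field with `d_K < -4`, a global minimal model of the
twist exists over `ℚ`, and `CornerTwistAt` applied there gives `BSDp Wd 3`. -/
theorem cornerTwistWitnessAt_of_cornerTwistAt (hnf : exists_isNewformOf)
    (hHL : HoffsteinLuo1997_exists_twist_L_one_ne_zero)
    (W : WeierstrassCurve ℚ) [W.IsElliptic] [W.IsGloballyMinimal]
    (hTw : CornerTwistAt W) : CornerTwistWitnessAt W := by
  intro hX hns
  have hr : W.analyticRank = 1 := hX.1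
  have hw : W.rootNumber = -1 := by
    rw [WeierstrassCurve.rootNumber_eq_neg_one_pow_analyticRank_of_exists_isNewformOf hnf W, hr]
    norm_num
  obtain ⟨K, _, _, hK, hodd, hlt, hHN, hH3, hLt⟩ :=
    exists_admissibleField_of_rootNumber_eq_neg_one hnf hHL W hw 3
  have hD0 : (NumberField.discr K : ℚ) ≠ 0 := by exact_mod_cast NumberField.discr_ne_zero K
  haveI hEt : (W.quadraticTwist (NumberField.discr K : ℚ)).IsElliptic := W.isElliptic_quadraticTwist hD0
  obtain ⟨Cd, hCd⟩ := hasGlobalMinimalModel_rat_holds (W.quadraticTwist (NumberField.discr K : ℚ))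
  haveI := hCd
  exact ⟨K, inferInstance, inferInstance, Cd • W.quadraticTwist (NumberField.discr K : ℚ), inferInstance,
    hCd, Cd, hK, hodd, hlt, hHN, hH3, hLt, rfl,
    hTw K (Cd • W.quadraticTwist (NumberField.discr K : ℚ)) Cd hX hns hK hodd hHN hLt rfl⟩

/-- Class-wide corollary: the filed conjunct implies the proposed replacement item. -/
theorem cornerTwistWitness_of_forall_cornerTwistAt (hnf : exists_isNewformOf)
    (hHL : HoffsteinLuo1997_exists_twist_L_one_ne_zero)
    (hTw : ∀ (W : WeierstrassCurve ℚ) [W.IsElliptic] [W.IsGloballyMinimal], CornerTwistAt W) :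
    CornerTwistWitness := by
  intro W _ _
  exact cornerTwistWitnessAt_of_cornerTwistAt hnf hHL W (hTw W)

/-- **The recut SUFFICES for the consumer (lower half)** — replay of
`X11b.Three.missingLowerBoundAt_of_cornerStepLAt_of_cornerTwistAt` with `exists_oddHeegnerData`
replaced by the supplied witness: the field `K` and the twin's `BSD₃` come from `CornerTwistWitnessAt W`,
the Manin-good Heegner datum over THAT `K` from `exists_maninDatum_of_odd`, STEP L (`CornerStepLAt`, still
∀-`K`) is applied at the supplied `K`. Same PUBLISHED binders minus Hoffstein–Luo. -/
theorem missingLowerBoundAt_of_cornerStepLAt_of_cornerTwistWitnessAt [Fact (Nat.Prime 3)]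
    (hGZ : ∀ (N : ℕ) [NeZero N] (W : WeierstrassCurve ℚ) (K : Type) [Field K] [NumberField K],
      gross_zagier N W K)
    (hKo : ∀ (N : ℕ) [NeZero N] (W : WeierstrassCurve ℚ) (K : Type) [Field K] [NumberField K],
      kolyvagin N W K)
    (hGZK : rank_eq_analyticRank_of_analyticRank_le_one) (hmod : hasEntireLFunction_rat)
    (hnf : exists_isNewformOf) (hMaz : mazur_not_dvd_maninConstant_of_odd)
    (hPT : ∀ (K : Type) [Field K] [NumberField K], poitouTate_sum_localTatePairing_eq_zero K)
    (hEP : ∀ (K : Type) [Field K] [NumberField K] (v : HeightOneSpectrum (𝓞 K)),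
      localEulerPoincareCharacteristic (v.adicCompletion K))
    (W : WeierstrassCurve ℚ) [W.IsElliptic] [W.IsGloballyMinimal] (hX : ClassX11b W 3)
    (hns : ¬ Surj W 3) (hSL : CornerStepLAt W) (hWit : CornerTwistWitnessAt W) :
    Typed.MissingLowerBoundAt W 3 := by
  have hNS : integral_neronScaling_of_isGloballyMinimal :=
    integral_neronScaling_of_isGloballyMinimal_holds
  obtain ⟨hr, hp2, hmult, hirr⟩ := id hX
  haveI : NeZero (W.conductorNorm ℤ) := ⟨(W.conductorNorm_pos_holds).ne'⟩
  obtain ⟨K, _, _, Wd, _, _, Cd, hK, hodd, hlt, hHN, hH3, hLt, hWd, hbsd⟩ := hWit hX hns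
  have hpd : ¬ (3 : ℤ) ∣ NumberField.discr K := not_dvd_discr_of_split hK Nat.prime_three hp2 hH3
  have hμ : ¬ 3 ∣ Units.torsionOrder K := by
    haveI : IsTotallyComplex K := hK.2
    rw [Literature.NumberTheory.DiophantineGeometry.torsionOrder_eq_two_of_discr_lt hK.1 hlt]
    omega
  obtain ⟨Dt, H, ι, P, hP, hc⟩ :=
    exists_maninDatum_of_odd hnf hMaz hNS W 3 (W.conductorNorm ℤ) K rfl hp2 hmult hirr hK hHN
  have htam : padicValNat 3 Wd.tamagawaProduct = padicValNat 3 W.tamagawaProduct :=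
    X2.padicValNat_tamagawaProduct_twist_of_heegner_of_odd W 3 hp2 K hK hodd hpd hHN Cd hWd
  have hu : padicValRat 3 (Cd.u : ℚ) = 0 :=
    padicValRat_u_eq_zero_of_twist_minimal W 3 K hK hHN hmult Cd hWd
  -- the twin's `≤`-half in `PPartRankZero` currency, from the supplied `BSDp Wd 3`
  have hD0 : (NumberField.discr K : ℚ) ≠ 0 := by exact_mod_cast NumberField.discr_ne_zero K
  haveI hEt : (W.quadraticTwist (NumberField.discr K : ℚ)).IsElliptic := W.isElliptic_quadraticTwist hD0
  have hLt' : (W.quadraticTwist (NumberField.discr K : ℚ)).entireLFunction = Wd.entireLFunction := by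
    rw [← hWd, entireLFunction_smul]
  have hLd1 : Wd.entireLFunction 1 ≠ 0 := by rw [← hLt']; exact hLt
  have hrd : Wd.analyticRank = 0 := (Wd.analyticRank_eq_zero_iff_holds (hmod Wd)).2 hLd1
  obtain ⟨qd, hqd, hv⟩ : PPartRankZero Wd 3 :=
    pPartRankZero_of_pPart hGZK Wd 3 hrd (pPart_of_bsdp hmod hGZK Wd 3 (by omega) hbsd)
  exact missingLowerBoundAt_of_indexLowerBoundAt W 3 (W.conductorNorm ℤ) K Dt H ι P (hGZ _ W K)
    (hKo _ W K) hGZK hmod hK hHN hP hp2 hc hμ hr hLt Wd Cd hWd hu htam ⟨qd, hqd, hv.ge⟩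
    (fun _ ↦ indexLowerBoundAt_of_cornerStepLAt hGZ hKo hmod hPT hEP W hX hns hSL (W.conductorNorm ℤ)
      K Dt H ι P rfl hK hodd hHN hLt hP hc)

/-- **The recut SUFFICES for the consumer (upper half, carriers `3 ∣ ∏c`)** — replay of
`X11b.Three.missingUpperBoundAt_of_cornerUpperAt` at the supplied witness (`CornerUpperAt` still ∀-`K`,
applied at the supplied `K`). Same PUBLISHED binders minus Hoffstein–Luo. -/
theorem missingUpperBoundAt_of_cornerUpperAt_of_cornerTwistWitnessAt [Fact (Nat.Prime 3)]
    (hGZ : ∀ (N : ℕ) [NeZero N] (W : WeierstrassCurve ℚ) (K : Type) [Field K] [NumberField K],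
      gross_zagier N W K)
    (hKo : ∀ (N : ℕ) [NeZero N] (W : WeierstrassCurve ℚ) (K : Type) [Field K] [NumberField K],
      kolyvagin N W K)
    (hGZK : rank_eq_analyticRank_of_analyticRank_le_one) (hmod : hasEntireLFunction_rat)
    (hnf : exists_isNewformOf) (hMaz : mazur_not_dvd_maninConstant_of_odd)
    (W : WeierstrassCurve ℚ) [W.IsElliptic] [W.IsGloballyMinimal] (hX : ClassX11b W 3)
    (hns : ¬ Surj W 3) (ht : 3 ∣ W.tamagawaProduct) (hU : CornerUpperAt W) (hWit : CornerTwistWitnessAt W) :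
    Typed.MissingUpperBoundAt W 3 := by
  have hNS : integral_neronScaling_of_isGloballyMinimal :=
    integral_neronScaling_of_isGloballyMinimal_holds
  obtain ⟨hr, hp2, hmult, hirr⟩ := id hX
  haveI : NeZero (W.conductorNorm ℤ) := ⟨(W.conductorNorm_pos_holds).ne'⟩
  obtain ⟨K, _, _, Wd, _, _, Cd, hK, hodd, hlt, hHN, hH3, hLt, hWd, hbsd⟩ := hWit hX hns
  have hpd : ¬ (3 : ℤ) ∣ NumberField.discr K := not_dvd_discr_of_split hK Nat.prime_three hp2 hH3
  have hμ : ¬ 3 ∣ Units.torsionOrder K := by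
    haveI : IsTotallyComplex K := hK.2
    rw [Literature.NumberTheory.DiophantineGeometry.torsionOrder_eq_two_of_discr_lt hK.1 hlt]
    omega
  obtain ⟨Dt, H, ι, P, hP, hc⟩ :=
    exists_maninDatum_of_odd hnf hMaz hNS W 3 (W.conductorNorm ℤ) K rfl hp2 hmult hirr hK hHN
  have htam : padicValNat 3 Wd.tamagawaProduct = padicValNat 3 W.tamagawaProduct :=
    X2.padicValNat_tamagawaProduct_twist_of_heegner_of_odd W 3 hp2 K hK hodd hpd hHN Cd hWd
  have hu : padicValRat 3 (Cd.u : ℚ) = 0 :=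
    padicValRat_u_eq_zero_of_twist_minimal W 3 K hK hHN hmult Cd hWd
  have hD0 : (NumberField.discr K : ℚ) ≠ 0 := by exact_mod_cast NumberField.discr_ne_zero K
  haveI hEt : (W.quadraticTwist (NumberField.discr K : ℚ)).IsElliptic := W.isElliptic_quadraticTwist hD0
  have hLt' : (W.quadraticTwist (NumberField.discr K : ℚ)).entireLFunction = Wd.entireLFunction := by
    rw [← hWd, entireLFunction_smul]
  have hLd1 : Wd.entireLFunction 1 ≠ 0 := by rw [← hLt']; exact hLt
  have hrd : Wd.analyticRank = 0 := (Wd.analyticRank_eq_zero_iff_holds (hmod Wd)).2 hLd1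
  obtain ⟨qd, hqd, hv⟩ : PPartRankZero Wd 3 :=
    pPartRankZero_of_pPart hGZK Wd 3 hrd (pPart_of_bsdp hmod hGZK Wd 3 (by omega) hbsd)
  exact missingUpperBoundAt_of_shaIndexBound_sharp W 3 (W.conductorNorm ℤ) K Dt H ι P (hGZ _ W K)
    (hKo _ W K) hGZK hmod hK hHN hP hp2 hc hμ hr hLt Wd Cd hWd hu htam le_rfl ⟨qd, hqd, hv.le⟩
    (fun hfin hPinf ↦ hU (W.conductorNorm ℤ) K Dt H ι P hX hns ht rfl hK hodd hHN hLt hP hc hPinf hfin)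

end Summit.BirchSwinnertonDyer.BirchSwinnertonDyer.Cruxes.CornerAtThree.OneDatumUnitTwin
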